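import Mathlib
import Summits.Ventures.PercRepro2.K5Hyper

/-!
# THE (i)-SIDE STAR COMPARISONS ON `K₅`: THE KRONECKER NUMBERS
(blind cell PercRepro2, typer-1 g10; mine-1 g18's MINE1-J1.md §23.5 — `M-(i)`, `TvT-(i)` and the
hyperedge base terms `N⁽ⁱ⁾(H + T(1))`, `N⁽ⁱ⁾(H + T(2))`; lead g26 03:34:15Z (5) «typer-1 folds it into the
M / TvT certificate plan»)

The cleared (i) of `K5Kernel.lean` is `kPos₁ = ABOL·Q·PD + QBL·PDoU·A`, `kNeg₁ = QBL·AO·PD + ABL·PDoU·Q` with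
`kPos₁ ≤ kNeg₁` digitwise (`cert_i`: every coefficient of the cleared (i) is `≤ 0`), so the typed (i)
count of a pattern is `N⁽ⁱ⁾ = (negative products) − (positive products)` and every comparison has the
roles of `K5Hyper.lean` swapped: `M-(i) ≥ 0 ⟺ negT1e1 + posT1 ≥ posT1e1 + negT1` digitwise, etc.

The placement sums are written once, generically in the pattern kernel (`sumT1`, `sumT2`, `sumT1e1`,
`sumE3`), and instantiated at `posOnI` / `negOnI` (the (i) tables through the masks, bit tables as in
`K5Hyper.lean`).  Certificates (`K5HyperCertI*.lean`): `cert_MI_abc_xy : CertLE (kNegMI D P) (kPosMI D P)`,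
`cert_TvTI_abc : CertLE (kNegTvTI a b c) (kPosTvTI a b c)`, `cert_T1I_abc : CertLE (sumT1 posOnI D) (sumT1 negOnI D)`,
`cert_T2I_abc : CertLE (sumT2 posOnI D) (sumT2 negOnI D)`.  Python twin `k5hyper_i_typer.py`: `0` violations
on all `60` comparisons (max digit `3953 < 2^22`).
-/

namespace Summit.Ventures.PercRepro2

namespace K5

/-! ## The placement sums, generic in the pattern kernel -/

section Sums

variable (f : (Fin 10 → Bool) → (Fin 10 → Bool) → (Fin 10 → Bool) → ℕ)

/-- `D` open in exactly one copy. -/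
def sumT1 (D : Fin 10 → Bool) : ℕ := f D mNone mNone + f mNone D mNone + f mNone mNone D

/-- `D` open in exactly two copies. -/
def sumT2 (D : Fin 10 → Bool) : ℕ := f D D mNone + f D mNone D + f mNone D D

/-- `D` in one copy and `P` in one copy (`9` placements). -/
def sumT1e1 (D P : Fin 10 → Bool) : ℕ :=
  f (mOr D P) mNone mNone + f D P mNone + f D mNone P + f P D mNone + f mNone (mOr D P) mNone +
    f mNone D P + f P mNone D + f mNone P D + f mNone mNone (mOr D P)

/-- Three edge sets each in one copy, `P₁` in the copy `0`. -/
def sumE3a (P₁ P₂ P₃ : Fin 10 → Bool) : ℕ :=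
  f (mOr (mOr P₁ P₂) P₃) mNone mNone + f (mOr P₁ P₂) P₃ mNone + f (mOr P₁ P₂) mNone P₃ +
    f (mOr P₁ P₃) P₂ mNone + f P₁ (mOr P₂ P₃) mNone + f P₁ P₂ P₃ + f (mOr P₁ P₃) mNone P₂ + f P₁ P₃ P₂ +
    f P₁ mNone (mOr P₂ P₃)

/-- `P₁` in the copy `1`. -/
def sumE3b (P₁ P₂ P₃ : Fin 10 → Bool) : ℕ :=
  f (mOr P₂ P₃) P₁ mNone + f P₂ (mOr P₁ P₃) mNone + f P₂ P₁ P₃ + f P₃ (mOr P₁ P₂) mNone +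
    f mNone (mOr (mOr P₁ P₂) P₃) mNone + f mNone (mOr P₁ P₂) P₃ + f P₃ P₁ P₂ + f mNone (mOr P₁ P₃) P₂ +
    f mNone P₁ (mOr P₂ P₃)

/-- `P₁` in the copy `2`. -/
def sumE3c (P₁ P₂ P₃ : Fin 10 → Bool) : ℕ :=
  f (mOr P₂ P₃) mNone P₁ + f P₂ P₃ P₁ + f P₂ mNone (mOr P₁ P₃) + f P₃ P₂ P₁ + f mNone (mOr P₂ P₃) P₁ +
    f mNone P₂ (mOr P₁ P₃) + f P₃ mNone (mOr P₁ P₂) + f mNone P₃ (mOr P₁ P₂) + f mNone mNone (mOr (mOr P₁ P₂) P₃)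

/-- Three edge sets each in one copy (`27` placements). -/
def sumE3 (P₁ P₂ P₃ : Fin 10 → Bool) : ℕ := sumE3a f P₁ P₂ P₃ + sumE3b f P₁ P₂ P₃ + sumE3c f P₁ P₂ P₃

end Sums

/-! ## The (i) tables through the masks -/

/-- The positive products of the cleared (i) on the pattern `(S₁, S₂, S₃)`:
`kron ABOL · kron Q · kron PD + kron QBL · kron PDoU · kron A`, each copy through its mask. -/
def posOnI (S₁ S₂ S₃ : Fin 10 → Bool) : ℕ :=
  kron3 tABOL S₁ * kron3 tQ S₂ * kron3 tPD S₃ + kron3 tQBL S₁ * kron3 tPDoU S₂ * kron3 tA S₃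

/-- The negative products of the cleared (i) on the pattern `(S₁, S₂, S₃)`:
`kron QBL · kron AO · kron PD + kron ABL · kron PDoU · kron Q`. -/
def negOnI (S₁ S₂ S₃ : Fin 10 → Bool) : ℕ :=
  kron3 tQBL S₁ * kron3 tAO S₂ * kron3 tPD S₃ + kron3 tABL S₁ * kron3 tPDoU S₂ * kron3 tQ S₃

/-- **`M-(i) ≥ 0` as Kronecker numbers**, the typed (i) count being `neg − pos`:
`kPosMI = N(H+T(1)+e(1))⁻ + N(H+T(1))⁺`. -/
def kPosMI (D P : Fin 10 → Bool) : ℕ := sumT1e1 negOnI D P + sumT1 posOnI D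

/-- The other side of `M-(i)`. -/
def kNegMI (D P : Fin 10 → Bool) : ℕ := sumT1e1 posOnI D P + sumT1 negOnI D

/-- **`TvT-(i) ≥ 0` as Kronecker numbers**: `kPosTvTI = N(H+△(1,1,1))⁻ + N(H+T(1))⁺`. -/
def kPosTvTI (a b c : ℕ) : ℕ :=
  sumE3 negOnI (pairMask a b) (pairMask a c) (pairMask b c) + sumT1 posOnI (triMask a b c)

/-- The other side of `TvT-(i)`. -/
def kNegTvTI (a b c : ℕ) : ℕ :=
  sumE3 posOnI (pairMask a b) (pairMask a c) (pairMask b c) + sumT1 negOnI (triMask a b c)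

end K5

end Summit.Ventures.PercRepro2
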